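import Literature.AlgebraicGeometry.GroupSchemes.StrictBirationalGroupLaw
import Mathlib.AlgebraicGeometry.Birational.RationalMap
import HarnessLib

/-!
# Weil's construction, measure step: the domain of definition of `𝒳 ×_S 𝒳 ⤏ 𝒱` grows along a gluing
# (Artin, *Néron models*, §2 p. 222: «replacing `V′` by `V′ ∪ V′_s` increases `V′` and `W`»)

Topic `Literature/AlgebraicGeometry/GroupSchemes`, namespace `Literature.AlgebraicGeometry.GroupSchemes`.
KERNEL ONLY: theorems; no definition, no named fact, no instance, no `sorry`.  Cell `hodgecm-mathlib` (D-0151), road W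
(Néron capital), piece **(G2c)** of A-p06's W1c design (`W1cProbe-v6` `StageStep`, second conjunct): Artin's MEASURE of a
stage `(𝒱, j)` of Weil's construction for a birational group law `L` on `𝒳/S` is the domain of definition
`W(𝒱, j) ⊆ 𝒳 ×_S 𝒳` of the rational map `(a, b) ↦ j(a)·j(b) = j(ab)`, i.e. of the class of the partial map
`(dom, mul ≫ j)` (Mathlib `Scheme.RationalMap.domain`).

* `RationalMap.domain_le_domain_compHom` — for any rational map `f : X ⤏ Y` and morphism `g : Y → Z`,
  `dom(f) ⊆ dom(f ≫ g)`;
* `measure_le_measure_comp` — hence `W(𝒱, j) ⊆ W(𝒲, j ≫ i)` for every `S`-morphism `i : 𝒱 → 𝒲` (Artin: «this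
  increases `W`», the monotonicity used along `inl : V′ ↪ V′ ∪ V′_s`);
* `measure_lt_measure_comp_of_mem` — and `W(𝒱, j) < W(𝒲, j ≫ i)` as soon as ONE point outside `W(𝒱, j)` lies in
  `W(𝒲, j ≫ i)` (the strictness skeleton of the step; the point is Artin's `(x, s)` with `x·s` undefined in `V′`, which
  becomes defined in `V′ ∪ V′_s` — the chart is supplied by the caller).

HC_CM is not proved here; nothing here changes the floor.

## References
* [Artin1986NeronModels] M. Artin, *Néron models*, in *Arithmetic Geometry* (Cornell, Silverman eds.), Springer 1986, §2
  p. 222 (proof of Thm. 1.12: «the process terminates by noetherian induction on `W`»).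
* [GortzWedhorn2020] U. Görtz, T. Wedhorn, *Algebraic Geometry I*, 2nd ed. (2020), §(9.6) Def. 9.26 – Prop. 9.27 (p. 239)
  (rational maps, domain of definition).
-/

noncomputable section

namespace Literature.AlgebraicGeometry.GroupSchemes

open CategoryTheory CategoryTheory.Limits _root_.AlgebraicGeometry MonoidalCategory CartesianMonoidalCategory
open TopologicalSpace

universe u

/-! ## §1. Domains of definition only grow under composition on the right -/

/-- **`dom(f) ⊆ dom(f ≫ g)`**: composing a rational map `f : X ⤏ Y` with a morphism `g : Y → Z` can only enlarge the
domain of definition — every partial map representing `f` composed with `g` represents `f ≫ g` on the same open.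
[cite: GortzWedhorn2020, §(9.6) Def. 9.26 and Prop. 9.27 (p. 239)] -/
theorem RationalMap.domain_le_domain_compHom {X Y Z : Scheme.{u}} (f : X ⤏ Y) (g : Y ⟶ Z) :
    f.domain ≤ (f.compHom g).domain := by
  intro x hx
  obtain ⟨h, hxh, hh⟩ := Scheme.RationalMap.mem_domain.1 hx
  refine Scheme.RationalMap.mem_domain.2 ⟨h.compHom g, hxh, ?_⟩
  rw [Scheme.RationalMap.compHom_toRationalMap, hh]

/-! ## §2. Artin's measure is monotone along a gluing -/

variable {S : Scheme.{u}} {𝒳 : Over S} (L : BirationalGroupLaw 𝒳) {𝒱 𝒲 : Over S} (j : 𝒳 ⟶ 𝒱) (i : 𝒱 ⟶ 𝒲)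

/-- **Artin's measure grows along `i : 𝒱 → 𝒲`** («replacing `V′` by `V′ ∪ V′_s` increases `W`»): the domain of
definition of `(a,b) ↦ j(ab)` in `𝒳 ×_S 𝒳` is contained in that of `(a,b) ↦ i(j(ab))`.
[cite: Artin1986NeronModels, §2 p. 222 (proof of Thm. 1.12)] -/
theorem measure_le_measure_comp :
    (Scheme.PartialMap.toRationalMap
        (⟨L.dom, L.dense_dom.dense, L.mul ≫ j.left⟩ : Scheme.PartialMap (𝒳 ⊗ 𝒳).left 𝒱.left)).domain ≤
      (Scheme.PartialMap.toRationalMap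
        (⟨L.dom, L.dense_dom.dense, L.mul ≫ (j ≫ i).left⟩ : Scheme.PartialMap (𝒳 ⊗ 𝒳).left 𝒲.left)).domain := by
  have h : (⟨L.dom, L.dense_dom.dense, L.mul ≫ (j ≫ i).left⟩ : Scheme.PartialMap (𝒳 ⊗ 𝒳).left 𝒲.left) =
      (⟨L.dom, L.dense_dom.dense, L.mul ≫ j.left⟩ : Scheme.PartialMap (𝒳 ⊗ 𝒳).left 𝒱.left).compHom i.left := by
    simp only [Scheme.PartialMap.compHom, Over.comp_left, Category.assoc]
  rw [h, Scheme.RationalMap.compHom_toRationalMap]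
  exact RationalMap.domain_le_domain_compHom _ _

/-- **Strictness skeleton of Artin's step**: if moreover some point `w₀ ∈ 𝒳 ×_S 𝒳` outside the measure of `(𝒱, j)`
(Artin's `(x, s)` with `x·s` undefined in `V′`) lies in the measure of `(𝒲, j ≫ i)` (it is defined in `V′ ∪ V′_s`),
the measure has STRICTLY increased. [cite: Artin1986NeronModels, §2 p. 222 (proof of Thm. 1.12)] -/
theorem measure_lt_measure_comp_of_mem (w₀ : ↑(𝒳 ⊗ 𝒳).left)
    (hout : w₀ ∉ (Scheme.PartialMap.toRationalMap
        (⟨L.dom, L.dense_dom.dense, L.mul ≫ j.left⟩ : Scheme.PartialMap (𝒳 ⊗ 𝒳).left 𝒱.left)).domain)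
    (hin : w₀ ∈ (Scheme.PartialMap.toRationalMap
        (⟨L.dom, L.dense_dom.dense, L.mul ≫ (j ≫ i).left⟩ : Scheme.PartialMap (𝒳 ⊗ 𝒳).left 𝒲.left)).domain) :
    (Scheme.PartialMap.toRationalMap
        (⟨L.dom, L.dense_dom.dense, L.mul ≫ j.left⟩ : Scheme.PartialMap (𝒳 ⊗ 𝒳).left 𝒱.left)).domain <
      (Scheme.PartialMap.toRationalMap
        (⟨L.dom, L.dense_dom.dense, L.mul ≫ (j ≫ i).left⟩ : Scheme.PartialMap (𝒳 ⊗ 𝒳).left 𝒲.left)).domain :=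
  lt_of_le_of_ne (measure_le_measure_comp L j i) fun h => hout (h ▸ hin)

end Literature.AlgebraicGeometry.GroupSchemes

end
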